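import Mathlib.Analysis.Normed.Group.InfiniteSum
import Mathlib.Analysis.Normed.Field.Basic
import Mathlib.Topology.Algebra.InfiniteSum.Basic
import Mathlib.Algebra.Ring.Periodic
import Mathlib.Analysis.Complex.Basic
import HarnessLib

/-!
# Abel summation over `ℤ` against a periodic weight of mean zero (once and twice)

Topic `Literature/NumberTheory/LFunctions`; namespace
`Literature.NumberTheory.LFunctions.PeriodicAbel`. Definitions with bodies (the periodic primitive
`primitive`, its mean-zero correction `primitive₀`) and theorems; no named fact.

Let `w : ℤ → ℂ` be periodic of period `P ≥ 1` with `∑_{i mod P} w(i) = 0` — e.g. `w = χ` a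
non-trivial Dirichlet character, or `d ↦ χ(d)·𝟙[(d, c) = 1]`. Then `w` has a bounded periodic
**primitive** `W`, `W(n+1) - W(n) = w(n)` (`primitive`, `primitive_add_one_sub`), and after
subtracting its mean a bounded periodic primitive `W₀` of mean zero (`primitive₀`). For an
ABSOLUTELY summable `f : ℤ → ℂ` summation by parts needs no boundary terms:

* `tsum_mul_eq_tsum_mul_sub` — `∑ₙ v(n) f(n) = ∑ₙ V(n) (f(n-1) - f(n))` for any bounded `V` with
  `V(n+1) - V(n) = v(n)`;
* `tsum_const_mul_sub_eq_zero` — `∑ₙ μ (f(n-1) - f(n)) = 0` (the mean drops out);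
* `tsum_mul_eq_tsum_primitive₀_mul_sub` — `∑ₙ w(n) f(n) = ∑ₙ W₀(n) (f(n-1) - f(n))`;
* `tsum_mul_eq_tsum_mul_secondDiff` — **twice**:
  `∑ₙ w(n) f(n) = ∑ₙ W₀₀(n) (f(n-2) - 2f(n-1) + f(n))` with `W₀₀ = primitive₀` of
  `W₀ = primitive₀ w`, bounded by `4 P ∑_{i mod P} ‖w i‖` (`norm_primitive₀_primitive₀_le`);
* `norm_tsum_mul_le` — `‖∑ₙ U(n) h(n)‖ ≤ C ∑ₙ ‖h(n)‖` for `‖U‖ ≤ C`.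

This is the mechanism of **Hecke's convergence trick without Poisson summation**: for the rows
`∑_d χ(d) (cz+d)⁻¹ |cz+d|^{-2s}` of the weight-one Eisenstein series the right-hand side of the
twice-summed identity converges absolutely for `Re s > -1` and is `O((|c| Im z)^{-2-2σ})`, giving
the analytic continuation in `s` past `s = 0` row by row (Hecke 1927, §2; Schoeneberg, *Elliptic
Modular Functions*, VII §2; Weil, *Elliptic functions according to Eisenstein and Kronecker*, III).
The analytic input (difference bounds for the kernel) lives in the next file; here everything is
algebra of absolutely convergent series.

## References

* E. Hecke, *Theorie der Eisensteinschen Reihen höherer Stufe…*, Abh. Math. Sem. Hamburg 5 (1927),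
  §2.
* B. Schoeneberg, *Elliptic Modular Functions*, Springer (1974), Ch. VII §2.
* A. Weil, *Elliptic Functions according to Eisenstein and Kronecker*, Springer (1976), Ch. III.
-/

noncomputable section

open Finset Filter Function

namespace Literature.NumberTheory.LFunctions

namespace PeriodicAbel

/-! ### Summation by parts for absolutely convergent two-sided series -/

/-- **Summation by parts over `ℤ` without boundary terms**: if `V(n+1) - V(n) = v(n)`, `V` is
bounded and `∑ ‖f(n)‖ < ∞`, then `∑ₙ v(n) f(n) = ∑ₙ V(n) (f(n-1) - f(n))` (both absolutely
convergent). [folklore] -/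
theorem tsum_mul_eq_tsum_mul_sub {v V : ℤ → ℂ} (hV : ∀ n, V (n + 1) - V n = v n) {C : ℝ}
    (hC : ∀ n, ‖V n‖ ≤ C) {f : ℤ → ℂ} (hf : Summable fun n ↦ ‖f n‖) :
    ∑' n, v n * f n = ∑' n, V n * (f (n - 1) - f n) := by
  have hC0 : 0 ≤ C := (norm_nonneg _).trans (hC 0)
  have hf' : Summable f := hf.of_norm
  -- the three absolutely convergent pieces
  have h1 : Summable fun n ↦ V (n + 1) * f n :=
    Summable.of_norm_bounded (hf.mul_left C) fun n ↦ by
      rw [norm_mul]; exact mul_le_mul_of_nonneg_right (hC _) (norm_nonneg _)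
  have h2 : Summable fun n ↦ V n * f n :=
    Summable.of_norm_bounded (hf.mul_left C) fun n ↦ by
      rw [norm_mul]; exact mul_le_mul_of_nonneg_right (hC _) (norm_nonneg _)
  have h3 : Summable fun n ↦ V n * f (n - 1) := by
    have := (Equiv.subRight (1 : ℤ)).summable_iff.mpr h1
    refine this.congr fun n ↦ ?_
    simp [Equiv.subRight, sub_add_cancel]
  calc ∑' n, v n * f n = ∑' n, (V (n + 1) * f n - V n * f n) := by
        refine tsum_congr fun n ↦ ?_
        rw [← hV n]; ring
    _ = ∑' n, V (n + 1) * f n - ∑' n, V n * f n := h1.tsum_sub h2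
    _ = ∑' n, V n * f (n - 1) - ∑' n, V n * f n := by
        congr 1
        rw [← (Equiv.subRight (1 : ℤ)).tsum_eq (fun n ↦ V (n + 1) * f n)]
        refine tsum_congr fun n ↦ ?_
        simp [Equiv.subRight, sub_add_cancel]
    _ = ∑' n, V n * (f (n - 1) - f n) := by
        rw [← h3.tsum_sub h2]
        refine tsum_congr fun n ↦ ?_
        ring

/-- A constant weight sees nothing: `∑ₙ μ (f(n-1) - f(n)) = 0` for absolutely summable `f`.
[folklore] -/
theorem tsum_const_mul_sub_eq_zero (μ : ℂ) {f : ℤ → ℂ} (hf : Summable fun n ↦ ‖f n‖) :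
    ∑' n, μ * (f (n - 1) - f n) = 0 := by
  have hf' : Summable f := hf.of_norm
  have hs : Summable fun n ↦ f (n - 1) := (Equiv.subRight (1 : ℤ)).summable_iff.mpr hf'
  have h1 : ∑' b : ℤ, f (b - 1) = ∑' b, f b := (Equiv.subRight (1 : ℤ)).tsum_eq f
  rw [tsum_mul_left, hs.tsum_sub hf', h1, sub_self, mul_zero]

/-- `‖∑ₙ U(n) h(n)‖ ≤ C ∑ₙ ‖h(n)‖` for a weight bounded by `C` and `∑ ‖h‖ < ∞`. [folklore] -/
theorem norm_tsum_mul_le {U : ℤ → ℂ} {C : ℝ} (hC : ∀ n, ‖U n‖ ≤ C) {h : ℤ → ℂ}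
    (hh : Summable fun n ↦ ‖h n‖) : ‖∑' n, U n * h n‖ ≤ C * ∑' n, ‖h n‖ := by
  have hC0 : 0 ≤ C := (norm_nonneg _).trans (hC 0)
  have hb : ∀ n, ‖U n * h n‖ ≤ C * ‖h n‖ := fun n ↦ by
    rw [norm_mul]; exact mul_le_mul_of_nonneg_right (hC _) (norm_nonneg _)
  have hs : Summable fun n ↦ ‖U n * h n‖ :=
    Summable.of_nonneg_of_le (fun _ ↦ norm_nonneg _) hb (hh.mul_left C)
  calc ‖∑' n, U n * h n‖ ≤ ∑' n, ‖U n * h n‖ := norm_tsum_le_tsum_norm hs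
    _ ≤ ∑' n, C * ‖h n‖ := hs.tsum_le_tsum hb (hh.mul_left C)
    _ = C * ∑' n, ‖h n‖ := tsum_mul_left

/-! ### The periodic primitive of a periodic weight of mean zero -/

section Primitive

variable (P : ℕ) (w : ℤ → ℂ)

/-- The **periodic primitive** `W(n) = ∑_{0 ≤ i < n mod P} w(i)` of a `P`-periodic weight.
[folklore] -/
def primitive (n : ℤ) : ℂ := ∑ i ∈ range (Int.toNat (n % P)), w i

/-- The mean of the primitive over a period. [folklore] -/
def primitiveMean : ℂ := (∑ i ∈ range P, primitive P w i) / P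

/-- The **mean-zero periodic primitive** `W₀ = W - mean(W)`. [folklore] -/
def primitive₀ (n : ℤ) : ℂ := primitive P w n - primitiveMean P w

variable {P w}

/-- A `P`-periodic function is determined on `[0, P)`: `w(n mod P) = w(n)`. [folklore] -/
theorem apply_emod_eq (hw : Periodic w (P : ℤ)) (n : ℤ) : w (n % P) = w n := by
  have h : n % (P : ℤ) = n - (n / P) • (P : ℤ) := by
    rw [Int.emod_def, smul_eq_mul]; ring
  rw [h, hw.sub_zsmul_eq]

variable (hP : 0 < P)
include hP

/-- `0 ≤ n mod P`. [folklore] -/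
theorem emod_nonneg' (n : ℤ) : 0 ≤ n % (P : ℤ) :=
  Int.emod_nonneg _ (by exact_mod_cast hP.ne')

/-- `n mod P < P`. [folklore] -/
theorem emod_lt' (n : ℤ) : n % (P : ℤ) < P :=
  Int.emod_lt_of_pos _ (by exact_mod_cast hP)

/-- `toNat (n mod P) < P`. [folklore] -/
theorem toNat_emod_lt (n : ℤ) : Int.toNat (n % (P : ℤ)) < P := by
  have h1 := emod_lt' hP n
  have h2 := emod_nonneg' hP n
  omega

/-- **The primitive is a primitive**: `W(n+1) - W(n) = w(n)` for a `P`-periodic `w` of mean zero.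
[folklore] -/
theorem primitive_add_one_sub (hw : Periodic w (P : ℤ)) (hmean : ∑ i ∈ range P, w i = 0)
    (n : ℤ) : primitive P w (n + 1) - primitive P w n = w n := by
  unfold primitive
  set r : ℕ := Int.toNat (n % (P : ℤ)) with hr
  have hr0 : 0 ≤ n % (P : ℤ) := emod_nonneg' hP n
  have hrP : r < P := toNat_emod_lt hP n
  have hrn : (r : ℤ) = n % (P : ℤ) := by rw [hr]; exact Int.toNat_of_nonneg hr0
  have hwr : w r = w n := by rw [hrn]; exact apply_emod_eq hw n
  -- `n + 1 = (r + 1) + P * (n / P)`, so `(n + 1) mod P = (r + 1) mod P`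
  have hdec : n + 1 = ((r : ℤ) + 1) + (P : ℤ) * (n / P) := by
    have := Int.emod_add_mul_ediv n P
    rw [← hrn] at this
    linarith
  have hmod' : (n + 1) % (P : ℤ) = ((r : ℤ) + 1) % (P : ℤ) := by
    rw [hdec, Int.add_mul_emod_self_left]
  rcases lt_or_ge (r + 1) P with h | h
  · -- no wrap-around: (n+1) mod P = r + 1
    have hmod : (n + 1) % (P : ℤ) = (r : ℤ) + 1 := by
      rw [hmod']
      exact Int.emod_eq_of_lt (by positivity) (by exact_mod_cast h)
    have htn : Int.toNat ((n + 1) % (P : ℤ)) = r + 1 := by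
      rw [hmod]
      exact_mod_cast Int.toNat_natCast (r + 1)
    rw [htn, Finset.sum_range_succ, hwr]
    ring
  · -- wrap-around: r + 1 = P, (n+1) mod P = 0
    have hrP1 : r + 1 = P := le_antisymm (by omega) h
    have hmod : (n + 1) % (P : ℤ) = 0 := by
      rw [hmod']
      have : ((r : ℤ) + 1) = (P : ℤ) := by exact_mod_cast hrP1
      rw [this, Int.emod_self]
    rw [hmod, Int.toNat_zero, Finset.sum_range_zero, zero_sub]
    have : ∑ i ∈ range P, w i = ∑ i ∈ range r, w i + w r := by
      rw [← hrP1, Finset.sum_range_succ]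
    rw [this, hwr] at hmean
    linear_combination -hmean

/-- The primitive is bounded: `‖W(n)‖ ≤ ∑_{i mod P} ‖w(i)‖`. [folklore] -/
theorem norm_primitive_le (n : ℤ) : ‖primitive P w n‖ ≤ ∑ i ∈ range P, ‖w i‖ := by
  unfold primitive
  refine (norm_sum_le _ _).trans ?_
  exact Finset.sum_le_sum_of_subset_of_nonneg
    (Finset.range_subset_range.mpr (toNat_emod_lt hP n).le) fun _ _ _ ↦ norm_nonneg _

omit hP in
/-- The primitive is `P`-periodic. [folklore] -/
theorem primitive_periodic : Periodic (primitive P w) (P : ℤ) := by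
  intro n
  unfold primitive
  rw [Int.add_emod_right]

omit hP in
/-- The mean-zero primitive is `P`-periodic. [folklore] -/
theorem primitive₀_periodic : Periodic (primitive₀ P w) (P : ℤ) := by
  intro n
  unfold primitive₀
  rw [primitive_periodic n]

/-- The mean-zero primitive has mean zero over a period. [folklore] -/
theorem sum_range_primitive₀ : ∑ i ∈ range P, primitive₀ P w i = 0 := by
  unfold primitive₀ primitiveMean
  rw [Finset.sum_sub_distrib, Finset.sum_const, Finset.card_range, nsmul_eq_mul]
  have hP' : (P : ℂ) ≠ 0 := by exact_mod_cast hP.ne'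
  field_simp
  ring

/-- `W₀(n+1) - W₀(n) = w(n)` as well. [folklore] -/
theorem primitive₀_add_one_sub (hw : Periodic w (P : ℤ)) (hmean : ∑ i ∈ range P, w i = 0)
    (n : ℤ) : primitive₀ P w (n + 1) - primitive₀ P w n = w n := by
  unfold primitive₀
  rw [sub_sub_sub_cancel_right, primitive_add_one_sub hP hw hmean]

/-- The mean-zero primitive is bounded: `‖W₀(n)‖ ≤ 2 ∑_{i mod P} ‖w(i)‖`. [folklore] -/
theorem norm_primitive₀_le (n : ℤ) : ‖primitive₀ P w n‖ ≤ 2 * ∑ i ∈ range P, ‖w i‖ := by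
  unfold primitive₀ primitiveMean
  have hP' : (0 : ℝ) < P := by exact_mod_cast hP
  have hmean : ‖(∑ i ∈ range P, primitive P w i) / (P : ℂ)‖ ≤ ∑ i ∈ range P, ‖w i‖ := by
    rw [norm_div, Complex.norm_natCast, div_le_iff₀ hP']
    calc ‖∑ i ∈ range P, primitive P w i‖ ≤ ∑ i ∈ range P, ‖primitive P w i‖ := norm_sum_le _ _
      _ ≤ ∑ i ∈ range P, ∑ j ∈ range P, ‖w j‖ :=
          Finset.sum_le_sum fun i _ ↦ norm_primitive_le hP i
      _ = (∑ i ∈ range P, ‖w i‖) * P := by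
          rw [Finset.sum_const, Finset.card_range, nsmul_eq_mul, mul_comm]
  calc ‖primitive P w n - (∑ i ∈ range P, primitive P w i) / (P : ℂ)‖
      ≤ ‖primitive P w n‖ + ‖(∑ i ∈ range P, primitive P w i) / (P : ℂ)‖ := norm_sub_le _ _
    _ ≤ ∑ i ∈ range P, ‖w i‖ + ∑ i ∈ range P, ‖w i‖ := add_le_add (norm_primitive_le hP n) hmean
    _ = 2 * ∑ i ∈ range P, ‖w i‖ := by ring

end Primitive

/-! ### Abel summation against a periodic weight of mean zero, once and twice -/

section Abel

variable {P : ℕ} (hP : 0 < P) {w : ℤ → ℂ} (hw : Periodic w (P : ℤ))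
  (hmean : ∑ i ∈ range P, w i = 0)
include hP hw hmean

/-- **Abel summation, once**: `∑ₙ w(n) f(n) = ∑ₙ W₀(n) (f(n-1) - f(n))` for `∑ ‖f‖ < ∞`, `W₀` the
mean-zero periodic primitive of `w`. [folklore] -/
theorem tsum_mul_eq_tsum_primitive₀_mul_sub {f : ℤ → ℂ} (hf : Summable fun n ↦ ‖f n‖) :
    ∑' n, w n * f n = ∑' n, primitive₀ P w n * (f (n - 1) - f n) :=
  tsum_mul_eq_tsum_mul_sub (primitive₀_add_one_sub hP hw hmean) (norm_primitive₀_le hP) hf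

/-- **Abel summation, twice**: `∑ₙ w(n) f(n) = ∑ₙ W₀₀(n) (f(n-2) - 2 f(n-1) + f(n))` for
`∑ ‖f‖ < ∞`, where `W₀₀ = primitive₀ P (primitive₀ P w)` is the mean-zero periodic primitive of
`W₀` (bounded by `4 P ∑_{i mod P} ‖w i‖`, `norm_primitive₀_primitive₀_le`). The right-hand side only
involves second differences of `f`. [folklore] -/
theorem tsum_mul_eq_tsum_mul_secondDiff {f : ℤ → ℂ} (hf : Summable fun n ↦ ‖f n‖) :
    ∑' n, w n * f n =
      ∑' n, primitive₀ P (primitive₀ P w) n * (f (n - 2) - 2 * f (n - 1) + f n) := by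
  -- once
  rw [tsum_mul_eq_tsum_primitive₀_mul_sub hP hw hmean hf]
  -- the new `f`
  set g : ℤ → ℂ := fun n ↦ f (n - 1) - f n with hg
  have hg_sum : Summable fun n ↦ ‖g n‖ := by
    have h1 : Summable fun n ↦ ‖f (n - 1)‖ := (Equiv.subRight (1 : ℤ)).summable_iff.mpr hf
    exact Summable.of_nonneg_of_le (fun _ ↦ norm_nonneg _) (fun n ↦ norm_sub_le _ _) (h1.add hf)
  -- twice, with the periodic mean-zero weight `W₀`
  have h2 := tsum_mul_eq_tsum_mul_sub
    (primitive₀_add_one_sub hP primitive₀_periodic (sum_range_primitive₀ hP))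
    (norm_primitive₀_le (w := primitive₀ P w) hP) hg_sum
  rw [show (∑' n, primitive₀ P w n * (f (n - 1) - f n)) = ∑' n, primitive₀ P w n * g n from rfl, h2]
  refine tsum_congr fun n ↦ ?_
  simp only [hg]
  ring_nf

omit hw hmean in
/-- The weight after two summations is bounded by `4 P ∑_{i mod P} ‖w(i)‖`. [folklore] -/
theorem norm_primitive₀_primitive₀_le (n : ℤ) :
    ‖primitive₀ P (primitive₀ P w) n‖ ≤ 4 * P * ∑ i ∈ range P, ‖w i‖ := by
  refine (norm_primitive₀_le hP n).trans ?_
  have h : ∑ i ∈ range P, ‖primitive₀ P w i‖ ≤ ∑ i ∈ range P, 2 * ∑ j ∈ range P, ‖w j‖ :=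
    Finset.sum_le_sum fun i _ ↦ norm_primitive₀_le hP i
  rw [Finset.sum_const, Finset.card_range, nsmul_eq_mul] at h
  linarith

/-- **The twice-summed bound**:
`‖∑ₙ w(n) f(n)‖ ≤ 4 P (∑_{i mod P} ‖w i‖) ∑ₙ ‖f(n-2) - 2f(n-1) + f(n)‖` whenever `∑ ‖f‖ < ∞`
and the second differences are absolutely summable. [folklore] -/
theorem norm_tsum_mul_le_secondDiff {f : ℤ → ℂ} (hf : Summable fun n ↦ ‖f n‖)
    (hf2 : Summable fun n ↦ ‖f (n - 2) - 2 * f (n - 1) + f n‖) :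
    ‖∑' n, w n * f n‖ ≤
      (4 * P * ∑ i ∈ range P, ‖w i‖) * ∑' n, ‖f (n - 2) - 2 * f (n - 1) + f n‖ := by
  rw [tsum_mul_eq_tsum_mul_secondDiff hP hw hmean hf]
  exact norm_tsum_mul_le (norm_primitive₀_primitive₀_le hP) hf2

end Abel

end PeriodicAbel

end Literature.NumberTheory.LFunctions
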